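import Mathlib.Analysis.SpecificLimits.Basic

/-!
# Negative knowledge for crux `OSLegsFromFemtoAndGap` (stmt-QuantumFields-9367): the abstract
ultralocality no-go

Support file (`--supports stmt-QuantumFields-9367`, cdisprove gen 2 cycle 1; mirrors §8 of
`Summits/QuantumFields/YangMills/Cruxes/OSLegsFromFemtoAndGap/Disproof.lean`, where the dictionary
to the crux and the repair menu live). Pure real analysis, no project imports:

* `logConvex_eq_zero_of_one`, `logConvex_pos`, `logConvex_pos_of_pos_at` — zero/positivity
  patterns of 3-term log-convex sequences (`h (n+1)² ≤ h n · h (n+2)`);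
* `logConvex_ratio_mono`, `logConvex_block`, `logConvex_pow_le` — ratio monotonicity, the block
  inequality `h s / h 0 ≤ h (m+s) / h m` and `(h s / h 0)^q ≤ h (q s) / h 0`, denominators cleared;
* `ultralocality_noGo` — if non-negative log-convex `G k` (bare reflection-positive two-point
  functions in the lattice time at step `k`) have renormalised values `c k · G k 0`,
  `c k · G k (s k)` converging to POSITIVE limits, then `G k (q · s k) / G k 0 ↛ 0`: the mechanism
  by which a unit map decaying faster than the clustering scale admits no non-trivial reflection-
  positive continuum two-point function (the "fake unit map" threat to the crux as typed), isolated
  from its physical input (two-sided clustering on large tori), which is NOT a hypothesis of the crux.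

No route decl is asserted or denied here.
-/

namespace Summit.QuantumFields.YangMills.Theorems.OSLegsFromFemtoAndGap.Negative

open Filter Topology

/-- Zeros propagate forward along a log-convex sequence: `h 1 = 0 ⇒ h n = 0` for all `n ≥ 1`
(so a 3-term log-convex non-negative sequence is either `(h₀, 0, 0, …)` or positive from `1` on).
[folklore] -/
theorem logConvex_eq_zero_of_one {h : ℕ → ℝ}
    (hlc : ∀ n, h (n + 1) ^ 2 ≤ h n * h (n + 2)) (h1 : h 1 = 0) :
    ∀ n, 1 ≤ n → h n = 0 := by
  intro n hn
  induction n with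
  | zero => omega
  | succ k ih =>
    rcases Nat.eq_zero_or_pos k with rfl | hk
    · simpa using h1
    · have hk0 : h k = 0 := ih hk
      obtain ⟨j, rfl⟩ : ∃ j, k = j + 1 := ⟨k - 1, by omega⟩
      have hsq : h (j + 1 + 1) ^ 2 ≤ 0 := by
        have := hlc (j + 1)
        rw [hk0, zero_mul] at this
        exact this
      exact pow_eq_zero_iff (two_ne_zero) |>.mp (le_antisymm hsq (sq_nonneg _))

/-- Positivity propagates along a log-convex sequence with `h 0, h 1 > 0`. [folklore] -/
theorem logConvex_pos {h : ℕ → ℝ}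
    (hlc : ∀ n, h (n + 1) ^ 2 ≤ h n * h (n + 2)) (hp0 : 0 < h 0) (hp1 : 0 < h 1) :
    ∀ n, 0 < h n := by
  intro n
  induction n using Nat.strong_induction_on with
  | _ n ih =>
    match n with
    | 0 => exact hp0
    | 1 => exact hp1
    | k + 2 =>
      have hk : 0 < h k := ih k (by omega)
      have hk1 : 0 < h (k + 1) := ih (k + 1) (by omega)
      by_contra hneg
      push Not at hneg
      nlinarith [hlc k, mul_pos hk1 hk1, hk, hneg]

/-- A non-negative log-convex sequence positive at `0` and at some `s ≥ 1` is positive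
everywhere. [folklore] -/
theorem logConvex_pos_of_pos_at {h : ℕ → ℝ} (h0 : ∀ n, 0 ≤ h n)
    (hlc : ∀ n, h (n + 1) ^ 2 ≤ h n * h (n + 2)) (hp0 : 0 < h 0) {s : ℕ} (hs : 1 ≤ s)
    (hps : 0 < h s) : ∀ n, 0 < h n := by
  refine logConvex_pos hlc hp0 ?_
  rcases (h0 1).lt_or_eq with h1 | h1
  · exact h1
  · exact absurd (logConvex_eq_zero_of_one hlc h1.symm s hs) hps.ne'

/-- Ratio monotonicity of a positive log-convex sequence, cleared of denominators:
`h (m+1) / h m ≤ h (m+s+1) / h (m+s)`. [folklore] -/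
theorem logConvex_ratio_mono {h : ℕ → ℝ} (hpos : ∀ n, 0 < h n)
    (hlc : ∀ n, h (n + 1) ^ 2 ≤ h n * h (n + 2)) :
    ∀ m s : ℕ, h (m + 1) * h (m + s) ≤ h m * h (m + s + 1) := by
  intro m s
  induction s with
  | zero => simp [mul_comm]
  | succ s ih =>
    have hl := hlc (m + s)
    have hp := hpos (m + s)
    have hp1 := hpos (m + s + 1)
    have hm := hpos m
    have key : h (m + 1) * h (m + s + 1) * h (m + s) ≤ h m * h (m + s + 2) * h (m + s) := by
      calc h (m + 1) * h (m + s + 1) * h (m + s)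
          = (h (m + 1) * h (m + s)) * h (m + s + 1) := by ring
        _ ≤ (h m * h (m + s + 1)) * h (m + s + 1) :=
            mul_le_mul_of_nonneg_right ih hp1.le
        _ = h m * h (m + s + 1) ^ 2 := by ring
        _ ≤ h m * (h (m + s) * h (m + s + 2)) := mul_le_mul_of_nonneg_left hl hm.le
        _ = h m * h (m + s + 2) * h (m + s) := by ring
    have := le_of_mul_le_mul_right key hp
    simpa [Nat.add_assoc] using this

/-- Block inequality: `h s / h 0 ≤ h (m+s) / h m` for a positive log-convex sequence. [folklore] -/
theorem logConvex_block {h : ℕ → ℝ} (hpos : ∀ n, 0 < h n)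
    (hlc : ∀ n, h (n + 1) ^ 2 ≤ h n * h (n + 2)) :
    ∀ m s : ℕ, h s * h m ≤ h (m + s) * h 0 := by
  intro m s
  induction s with
  | zero => simp [mul_comm]
  | succ s ih =>
    have hr : h (s + 1) * h (s + m) ≤ h s * h (s + m + 1) := logConvex_ratio_mono hpos hlc s m
    have hs := hpos s
    have hm := hpos m
    have hsm1 := hpos (s + m + 1)
    have key : h (s + 1) * h m * (h s * h (m + s)) ≤
        h (m + (s + 1)) * h 0 * (h s * h (m + s)) := by
      calc h (s + 1) * h m * (h s * h (m + s))
          = (h (s + 1) * h (s + m)) * (h s * h m) := by rw [Nat.add_comm m s]; ring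
        _ ≤ (h s * h (s + m + 1)) * (h s * h m) :=
            mul_le_mul_of_nonneg_right hr (mul_pos hs hm).le
        _ = (h s * h m) * (h s * h (s + m + 1)) := by ring
        _ ≤ (h (m + s) * h 0) * (h s * h (s + m + 1)) :=
            mul_le_mul_of_nonneg_right ih (mul_pos hs hsm1).le
        _ = h (m + (s + 1)) * h 0 * (h s * h (m + s)) := by
            rw [show s + m + 1 = m + (s + 1) by omega, Nat.add_comm m s]; ring
    have hpos2 : 0 < h s * h (m + s) := mul_pos hs (hpos _)
    exact le_of_mul_le_mul_right key hpos2

/-- Power inequality: `(h s / h 0) ^ q ≤ h (q s) / h 0` for a positive log-convex sequence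
(log-convexity along the arithmetic progression `0, s, 2s, …`). [folklore] -/
theorem logConvex_pow_le {h : ℕ → ℝ} (hpos : ∀ n, 0 < h n)
    (hlc : ∀ n, h (n + 1) ^ 2 ≤ h n * h (n + 2)) :
    ∀ q s : ℕ, h s ^ q * h 0 ≤ h (q * s) * h 0 ^ q := by
  intro q s
  induction q with
  | zero => simp
  | succ q ih =>
    have hb := logConvex_block hpos hlc (q * s) s
    have hs := hpos s
    have h0 := hpos 0
    calc h s ^ (q + 1) * h 0 = h s * (h s ^ q * h 0) := by ring
      _ ≤ h s * (h (q * s) * h 0 ^ q) := mul_le_mul_of_nonneg_left ih hs.le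
      _ = (h s * h (q * s)) * h 0 ^ q := by ring
      _ ≤ (h (q * s + s) * h 0) * h 0 ^ q := mul_le_mul_of_nonneg_right hb (pow_pos h0 q).le
      _ = h ((q + 1) * s) * h 0 ^ (q + 1) := by rw [Nat.succ_mul]; ring

/-- **Abstract ultralocality no-go** (the mechanism of Disproof.lean §6 / ideator-2 F1, kernel-checked). Let
`G k : ℕ → ℝ` be non-negative log-convex sequences (bare centred OS two-point functions in the
lattice time separation at step `k`), `c k` scalars (squared curvature renormalisations),
`s k : ℕ` the lattice index of one physical separation `σ > 0` and `q : ℕ`. If the renormalised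
values converge to POSITIVE limits at separation `0` (non-triviality, diagonalised by RP) and at
`s k` (continuity of the limit under small translations), then the bare ratios
`G k (q · s k) / G k 0` cannot tend to `0` — whereas two-sided clustering in units `b` with
`b/a → ∞` along the scheme forces exactly that for `q σ` beyond the lower bound's horizon. So along
a fake unit map (`a ≪ a_phys`) no `IsYangMillsFor`-limit is `IsNontrivial` in the curvature —
GIVEN the two-sided large-torus clustering input [D] of the Disproof.lean docblock, which is not a hypothesis of
the crux and not provable today. [folklore] -/
theorem ultralocality_noGo {G : ℕ → ℕ → ℝ} {c : ℕ → ℝ} {s : ℕ → ℕ} {q : ℕ} {S₀ Sσ : ℝ}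
    (hG0 : ∀ k n, 0 ≤ G k n) (hlc : ∀ k n, G k (n + 1) ^ 2 ≤ G k n * G k (n + 2))
    (h0 : Tendsto (fun k => c k * G k 0) atTop (𝓝 S₀)) (hS₀ : 0 < S₀)
    (hσ : Tendsto (fun k => c k * G k (s k)) atTop (𝓝 Sσ)) (hSσ : 0 < Sσ)
    (hdecay : Tendsto (fun k => G k (q * s k) / G k 0) atTop (𝓝 0)) : False := by
  set ρ : ℝ := min (Sσ / (4 * S₀)) (1 / 2) with hρ
  have hρpos : 0 < ρ := lt_min (by positivity) (by norm_num)
  have hρle : ρ ≤ 1 := (min_le_right _ _).trans (by norm_num)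
  have hρle' : ρ ≤ Sσ / (4 * S₀) := min_le_left _ _
  have e0 : ∀ᶠ k in atTop, S₀ / 2 < c k * G k 0 := h0.eventually (lt_mem_nhds (by linarith))
  have e0' : ∀ᶠ k in atTop, c k * G k 0 < 2 * S₀ := h0.eventually (gt_mem_nhds (by linarith))
  have eσ : ∀ᶠ k in atTop, Sσ / 2 < c k * G k (s k) := hσ.eventually (lt_mem_nhds (by linarith))
  have ed : ∀ᶠ k in atTop, G k (q * s k) / G k 0 < ρ ^ q :=
    hdecay.eventually (gt_mem_nhds (pow_pos hρpos q))
  obtain ⟨k, hk0, hk0', hkσ, hkd⟩ := (e0.and (e0'.and (eσ.and ed))).exists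
  have hG0pos : 0 < G k 0 := by
    rcases (hG0 k 0).lt_or_eq with h | h
    · exact h
    · exfalso; rw [← h, mul_zero] at hk0; linarith
  have hcpos : 0 < c k := by
    by_contra hc
    push Not at hc
    nlinarith [hG0 k 0]
  have hGσpos : 0 < G k (s k) := by
    by_contra hh
    push Not at hh
    nlinarith
  have hs : 1 ≤ s k := by
    by_contra hs'
    have hs0 : s k = 0 := by omega
    rw [hs0, mul_zero, div_self hG0pos.ne'] at hkd
    exact absurd (hkd.trans_le (pow_le_one₀ hρpos.le hρle)) (lt_irrefl _)
  have hpos : ∀ n, 0 < G k n := logConvex_pos_of_pos_at (hG0 k) (hlc k) hG0pos hs hGσpos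
  have hratio : ρ * G k 0 ≤ G k (s k) := by
    have h1 : Sσ * G k 0 ≤ 4 * S₀ * G k (s k) := by
      nlinarith [mul_le_mul_of_nonneg_right hkσ.le (hG0 k 0),
        mul_le_mul_of_nonneg_right hk0'.le (hG0 k (s k))]
    have h4S : 0 < 4 * S₀ := by positivity
    calc ρ * G k 0 ≤ Sσ / (4 * S₀) * G k 0 := mul_le_mul_of_nonneg_right hρle' (hG0 k 0)
      _ = Sσ * G k 0 / (4 * S₀) := by ring
      _ ≤ 4 * S₀ * G k (s k) / (4 * S₀) := div_le_div_of_nonneg_right h1 h4S.le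
      _ = G k (s k) := by field_simp
  have hpow := logConvex_pow_le hpos (hlc k) q (s k)
  have h2 : (ρ * G k 0) ^ q * G k 0 ≤ G k (q * s k) * G k 0 ^ q :=
    (mul_le_mul_of_nonneg_right
      (pow_le_pow_left₀ (mul_pos hρpos hG0pos).le hratio q) hG0pos.le).trans hpow
  have h3 : ρ ^ q * G k 0 ≤ G k (q * s k) := by
    have : ρ ^ q * G k 0 * G k 0 ^ q ≤ G k (q * s k) * G k 0 ^ q := by
      calc ρ ^ q * G k 0 * G k 0 ^ q = (ρ * G k 0) ^ q * G k 0 := by ring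
        _ ≤ G k (q * s k) * G k 0 ^ q := h2
    exact le_of_mul_le_mul_right this (pow_pos hG0pos q)
  have h4 : ρ ^ q ≤ G k (q * s k) / G k 0 := by
    rw [le_div_iff₀ hG0pos]; exact h3
  linarith

end Summit.QuantumFields.YangMills.Theorems.OSLegsFromFemtoAndGap.Negative
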